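import Mathlib
import HarnessLib
import Literature.Computability.Complexity.OccurrenceObstructionsIPProofs
import Literature.Computability.AlgebraicComplexity.OrbitCoordinateRingProofs
import Literature.Computability.AlgebraicComplexity.OrbitClosureWeights
import Literature.RingTheory.MvPolynomial.BihomogeneousCoefficients
import Literature.LinearAlgebra.Matrix.PermanentSubperm

/-!
# `ValuativeGCT.TailFlip` (stmt-ValiantsHypothesis-15687), line `Sketch` (idea `isobaric-anchors`):
# the registered stub `stub_isobaricSizeLift` — inner-size monotonicity of isobaric certificates

An ISOBARIC UNTWISTED CERTIFICATE at inner size `n` — highest-weight vectors `F₁ … F_D` of weight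
`μ*` (`μ ⊢ nδ`, `≤ n²` parts) on `ℂ[Sym^n ℂ^{n²}]`, inner points `A_l · per_n` all of whose monomials
have the same exponent `e₀ l` at the top variable `x_t = X (topMatIdx n)`, and a nonsingular
untwisted evaluation matrix `(F_i(A_l · per_n))_{i,l}` — yields one of the SAME size `D` at inner
size `n + i`, of shape `μ♯(n+i) = rowLift μ i` and isobaric degrees `e₀ l + i`:

* the vectors are the Kadish–Landsberg lifts `liftHWV n i F_i` (`liftHWV_mem_highestWeightSpace`);
* the points are the padded forms `x_t^i · (A_l · per_n)|segment = paddedForm n i (A_l · per_n)`,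
  which ARE endomorphism-orbit points of `per_{n+i}` (`sl_exists_linSubst_eq_paddedForm`: substitute
  into the `(n+i) × (n+i)` permanent the block matrix of linear forms
  `(A_l-forms on the segment) ⊕ x_t · 1_i`, whose permanent is `x_t^i · per_n(A_l-forms)` by the
  block formula `Matrix.permanent_fromBlocks_zero₂₁`), and which are isobaric of degree `e₀ l + i`
  (`sl_isobaric_paddedForm`, `segEmb_topMatIdx`);
* by `aeval_formCoeff_paddedForm_liftHWV` the evaluation matrix of the lifts at the padded points is
  the `Δ_i`-TWISTED inner matrix, and on isobaric points the twist is the nonzero column scalar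
  `((e₀ l + i)!/(e₀ l)!)^δ` (`sl_twistScalar`, `Matrix.det_mul_row`).

Sources: Ikenmeyer–Panova 2017 Prop. 2.6(b); Bürgisser–Ikenmeyer–Panova 2019 Lemma 5.2, Thm. 5.4;
Mulmuley–Sohoni 2001 §4 (endomorphism orbits); BLMW 2011 §6.4.
-/

-- the summit-side namespace `Summit.ValiantsHypothesis.ValiantsHypothesis.…` repeats a component by convention (D-0022)
set_option linter.dupNamespace false

namespace Summit.ValiantsHypothesis.ValiantsHypothesis.Theorems.TailFlip

open MvPolynomial
open scoped BigOperators Matrix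
open Literature.NumberTheory.DiophantineGeometry
open Literature.Computability.AlgebraicComplexity
open Literature.Computability.Complexity

noncomputable section

/-! ## Generic permanents under substitutions -/

/-- The unpadded permanent `paddedPerFormLex ℂ N N = per_N` as the renaming `(a, b) ↦ toLex (a, b)`
of the generic permanent `perPoly (Fin N) ℂ` (the block `BlockIdx N N` is all of `Fin N` and the
padding exponent is `N - N = 0`). [Mulmuley–Sohoni 2001 §4; folklore] -/
private theorem sl_paddedPerFormLex_self (N : ℕ) [NeZero N] :
    paddedPerFormLex ℂ N N =
      rename (fun ab : Fin N × Fin N => (toLex ab : MatIdx N)) (perPoly (Fin N) ℂ) := by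
  have hN : ∀ x : Fin N, N - N ≤ (x : ℕ) := fun x => by simp
  have hpow : (X (toLex ((0 : Fin N), (0 : Fin N))) : MvPolynomial (MatIdx N) ℂ) ^ (N - N) = 1 := by
    rw [Nat.sub_self, pow_zero]
  rw [paddedPerFormLex_eq, hpow, one_mul,
    ← rename_perPoly_equiv (k := ℂ) ((Equiv.subtypeUnivEquiv hN).symm : Fin N ≃ BlockIdx N N),
    rename_rename]
  rfl

/-- A linear substitution on a renamed polynomial is the evaluation at the images of the renamed
variables. [folklore] -/
-- copied from Theorems/ValuativeGCTValuativeFlipTwistedInheritance.lean (`linSubst_rename_eq_aeval`)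
private theorem sl_linSubst_rename_eq_aeval {α τ : Type*} [Fintype τ] (M : Matrix τ τ ℂ)
    (κ : α → τ) (P : MvPolynomial α ℂ) :
    linSubst τ ℂ M (rename κ P) = aeval (fun a => linSubst τ ℂ M (X (κ a))) P := by
  suffices H : (linSubst τ ℂ M).comp (rename κ) = aeval (fun a => linSubst τ ℂ M (X (κ a))) from
    congrArg (fun φ => φ P) H
  exact MvPolynomial.algHom_ext fun a => by simp only [AlgHom.comp_apply, rename_X, aeval_X]

/-- Renaming an evaluation is evaluating at the renamed images. [folklore] -/
-- copied from Theorems/ValuativeGCTValuativeFlipTwistedInheritance.lean (`rename_aeval_eq_aeval`)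
private theorem sl_rename_aeval_eq_aeval {α τ τ' : Type*} (ι : τ → τ') (G : α → MvPolynomial τ ℂ)
    (P : MvPolynomial α ℂ) :
    rename ι (aeval G P) = aeval (fun a => rename ι (G a)) P := by
  suffices H : (rename ι).comp (aeval G) = aeval (fun a => rename ι (G a)) from
    congrArg (fun φ => φ P) H
  exact MvPolynomial.algHom_ext fun a => by simp

/-- Evaluating the generic permanent: `aeval g per = per (g (i, j))`. [Bürgisser 2000, (2.2); folklore] -/
-- adapted from Literature/Computability/AlgebraicComplexity/BIPPaddingDegenerations.lean (`aeval_perPoly`)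
private theorem sl_aeval_perPoly {ι R : Type*} [Fintype ι] [DecidableEq ι] [CommRing R] [Algebra ℂ R]
    (g : ι × ι → R) : aeval g (perPoly ι ℂ) = (Matrix.of fun i j : ι => g (i, j)).permanent := by
  simp [perPoly, Matrix.permanent, map_sum, map_prod]

/-- A linear substitution instance `M · per_N` of the permanent is the permanent of the matrix of
linear forms `(M · X_{ab})_{a,b}`. [Mulmuley–Sohoni 2001 §4; folklore] -/
private theorem sl_linSubst_perSelf (N : ℕ) [NeZero N] (M : Matrix (MatIdx N) (MatIdx N) ℂ) :
    linSubst (MatIdx N) ℂ M (paddedPerFormLex ℂ N N) =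
      (Matrix.of fun a b : Fin N => linSubst (MatIdx N) ℂ M (X (toLex (a, b)))).permanent := by
  rw [sl_paddedPerFormLex_self, sl_linSubst_rename_eq_aeval, sl_aeval_perPoly]

/-- The padded inner point `x_t^i · (A · per_n)|segment` is `x_t^i` times the permanent of the
`n × n` matrix of segment-renamed `A`-linear forms. [Ikenmeyer–Panova 2017 §2.2; folklore] -/
private theorem sl_paddedForm_eq (n i : ℕ) [NeZero n] [NeZero (n + i)]
    (A : Matrix (MatIdx n) (MatIdx n) ℂ) :
    paddedForm n i (linSubst (MatIdx n) ℂ A (paddedPerFormLex ℂ n n)) =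
      X (topMatIdx (n + i)) ^ i *
        (Matrix.of fun a b : Fin n => ∑ r : MatIdx n, A r (toLex (a, b)) •
          (X (segEmb (Nat.le_add_right n i) r) : MvPolynomial (MatIdx (n + i)) ℂ)).permanent := by
  rw [paddedForm, sl_paddedPerFormLex_self, sl_linSubst_rename_eq_aeval, sl_rename_aeval_eq_aeval,
    sl_aeval_perPoly]
  simp only [linSubst_X, map_sum, map_smul, rename_X]

/-- **Block formula.** A square matrix of size `n + i` which, re-indexed along
`Fin n ⊕ Fin i ≃ Fin (n + i)`, is block diagonal `L ⊕ t · 1_i` has permanent `per L · t^i`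
(`Matrix.permanent_fromBlocks_zero₂₁` and the permanent of a diagonal matrix). [folklore] -/
private theorem sl_permanent_block {R : Type*} [CommRing R] {n i : ℕ}
    (S : Matrix (Fin (n + i)) (Fin (n + i)) R) (L : Matrix (Fin n) (Fin n) R) (t : R)
    (hS : ∀ x y, S (finSumFinEquiv x) (finSumFinEquiv y) =
      Matrix.fromBlocks L 0 0 (Matrix.diagonal fun _ : Fin i => t) x y) :
    S.permanent = L.permanent * t ^ i := by
  rw [← Matrix.permanent_submatrix_equiv finSumFinEquiv S]
  have h : S.submatrix finSumFinEquiv finSumFinEquiv =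
      Matrix.fromBlocks L 0 0 (Matrix.diagonal fun _ : Fin i => t) := Matrix.ext fun x y => hS x y
  rw [h, Matrix.permanent_fromBlocks_zero₂₁, Matrix.permanent_diagonal, Finset.prod_const,
    Finset.card_univ, Fintype.card_fin]

/-! ## The padded inner points are endomorphism-orbit points of `per_{n+i}` -/

/-- **The padded inner points are `End`-orbit points of the bigger permanent.**  For every
`A ∈ Mat_{n²}` there is `M ∈ Mat_{(n+i)²}` with `M · per_{n+i} = x_t^i · (A · per_n)|segment`
(`= paddedForm n i (A · per_n)`): substitute into `per_{n+i}` the block matrix of linear forms whose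
top-left `n × n` block is the segment copy of the `A`-forms, whose last `i` diagonal entries are the
top variable `x_t = X (topMatIdx (n + i))`, and whose remaining entries vanish.
[Mulmuley–Sohoni 2001 §4; Bürgisser–Ikenmeyer–Panova 2019 §1(a); Ikenmeyer–Panova 2017 §2.2] -/
private theorem sl_exists_linSubst_eq_paddedForm (n i : ℕ) [NeZero n] [NeZero (n + i)]
    (A : Matrix (MatIdx n) (MatIdx n) ℂ) :
    ∃ M : Matrix (MatIdx (n + i)) (MatIdx (n + i)) ℂ,
      linSubst (MatIdx (n + i)) ℂ M (paddedPerFormLex ℂ (n + i) (n + i)) =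
        paddedForm n i (linSubst (MatIdx n) ℂ A (paddedPerFormLex ℂ n n)) := by
  classical
  -- the columns of the substitution matrix, indexed by pairs of `Fin n ⊕ Fin i`
  let g : Fin n ⊕ Fin i → Fin n ⊕ Fin i → MatIdx (n + i) → ℂ := fun x y s =>
    Sum.elim
      (fun a : Fin n => Sum.elim
        (fun b : Fin n => ∑ r : MatIdx n,
          if segEmb (Nat.le_add_right n i) r = s then A r (toLex (a, b)) else 0)
        (fun _ : Fin i => (0 : ℂ)) y)
      (fun c : Fin i => Sum.elim (fun _ : Fin n => (0 : ℂ))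
        (fun c' : Fin i => if c = c' then (if s = topMatIdx (n + i) then 1 else 0) else 0) y) x
  have hg : ∀ x y, (∑ s : MatIdx (n + i), g x y s • (X s : MvPolynomial (MatIdx (n + i)) ℂ)) =
      Matrix.fromBlocks
        (Matrix.of fun a b : Fin n => ∑ r : MatIdx n, A r (toLex (a, b)) •
          (X (segEmb (Nat.le_add_right n i) r) : MvPolynomial (MatIdx (n + i)) ℂ))
        0 0 (Matrix.diagonal fun _ : Fin i => (X (topMatIdx (n + i)) : MvPolynomial (MatIdx (n + i)) ℂ))
        x y := by
    rintro (a | c) (b | c')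
    · simp only [g, Sum.elim_inl, Matrix.fromBlocks_apply₁₁, Matrix.of_apply, Finset.sum_smul,
        ite_smul, zero_smul]
      rw [Finset.sum_comm]
      refine Finset.sum_congr rfl fun r _ => ?_
      rw [Finset.sum_ite_eq Finset.univ (segEmb (Nat.le_add_right n i) r), if_pos (Finset.mem_univ _)]
    · simp [g]
    · simp [g]
    · simp only [g, Sum.elim_inr, Matrix.fromBlocks_apply₂₂, Matrix.diagonal_apply]
      by_cases hcc : c = c'
      · simp only [hcc, if_true, ite_smul, one_smul, zero_smul]
        rw [Finset.sum_ite_eq' Finset.univ (topMatIdx (n + i)), if_pos (Finset.mem_univ _)]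
      · simp [hcc]
  let M : Matrix (MatIdx (n + i)) (MatIdx (n + i)) ℂ := fun s idx =>
    g (finSumFinEquiv.symm (ofLex idx).1) (finSumFinEquiv.symm (ofLex idx).2) s
  refine ⟨M, ?_⟩
  rw [sl_linSubst_perSelf, sl_paddedForm_eq n i A, mul_comm]
  refine sl_permanent_block _ _ _ fun x y => ?_
  rw [Matrix.of_apply, linSubst_X, ← hg x y]
  simp only [M, ofLex_toLex, Equiv.symm_apply_apply]

/-! ## Isobaricity and the twist -/

/-- Padding an `x_t`-isobaric form of degree `c` gives an `x_t`-isobaric form of degree `c + i`: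
the monomials of `x_t^i · f|segment` are `x_t^i` times segment copies of monomials of `f`, and the
segment embedding maps top index to top index (`segEmb_topMatIdx`). [folklore] -/
private theorem sl_isobaric_paddedForm (n i : ℕ) [NeZero n] [NeZero (n + i)]
    {f : MvPolynomial (MatIdx n) ℂ} {c : ℕ} (hf : ∀ e ∈ f.support, e (topMatIdx n) = c) :
    ∀ e ∈ (paddedForm n i f).support, e (topMatIdx (n + i)) = c + i := by
  classical
  intro e he
  rw [paddedForm] at he
  obtain ⟨a, ha, b, hb, rfl⟩ := Finset.mem_add.mp (support_mul _ _ he)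
  rw [support_X_pow, Finset.mem_singleton] at ha
  rw [support_rename_of_injective (segEmb_strictMono (Nat.le_add_right n i)).injective,
    Finset.mem_image] at hb
  obtain ⟨u, hu, rfl⟩ := hb
  rw [ha, Finsupp.add_apply, Finsupp.single_eq_same, ← segEmb_topMatIdx (Nat.le_add_right n i),
    Finsupp.mapDomain_apply (segEmb_strictMono (Nat.le_add_right n i)).injective, hf u hu, add_comm]

/-- **The twist is a scalar on isobaric forms.** For `F` homogeneous of degree `δ` in the
coefficient variables and `h` isobaric of `x_t`-degree `e₀`, the `Δ_j`-twisted evaluation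
(coefficient of `x^e` rescaled by `(e_t + j)!/e_t!`) is `((e₀+j)!/e₀!)^δ` times the untwisted one.
[Bürgisser–Ikenmeyer–Panova 2019 Lemma 5.2; folklore] -/
-- adapted from Cruxes/TailFlip/Sketch_ideator2.lean (`isobaricTwistScalar_holds`)
private theorem sl_twistScalar (n j δ e₀ : ℕ) [NeZero n] (F : MvPolynomial (DegIdx (MatIdx n) n) ℂ)
    (hF : F.IsHomogeneous δ) (h : MvPolynomial (MatIdx n) ℂ)
    (hiso : ∀ e ∈ h.support, e (topMatIdx n) = e₀) :
    aeval (fun e : DegIdx (MatIdx n) n =>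
        (((e.1 (topMatIdx n) + j).descFactorial j : ℕ) : ℂ) * coeff e.1 h) F =
      ((((e₀ + j).descFactorial j : ℕ) : ℂ) ^ δ) *
        aeval (fun e : DegIdx (MatIdx n) n => coeff e.1 h) F := by
  have hfun : (fun e : DegIdx (MatIdx n) n =>
        (((e.1 (topMatIdx n) + j).descFactorial j : ℕ) : ℂ) * coeff e.1 h) =
      (((e₀ + j).descFactorial j : ℕ) : ℂ) • (fun e : DegIdx (MatIdx n) n => coeff e.1 h) := by
    funext e
    simp only [Pi.smul_apply, smul_eq_mul]
    by_cases hc : coeff e.1 h = 0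
    · simp [hc]
    · rw [hiso e.1 (mem_support_iff.mpr hc)]
  rw [hfun]
  simp only [MvPolynomial.aeval_eq_eval]
  exact Literature.RingTheory.MvPolynomial.eval_smul_of_isHomogeneous hF _ _

/-! ## The stub -/

/-- **stub_isobaricSizeLift** (registered stub of line `Sketch`, verbatim).  An isobaric untwisted
certificate at inner size `n` — highest-weight vectors `F₁ … F_D` of weight `μ*`, `x_t`-isobaric
inner points `A_l · per_n` of degrees `e₀ l`, nonsingular untwisted evaluation matrix — yields one of
the SAME size `D` at inner size `n + i`, of shape `μ♯(n+i)` and isobaric degrees `e₀ l + i`: take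
`F' = liftHWV n i ∘ F` (`liftHWV_mem_highestWeightSpace`) and the `End`-orbit points
`M_l · per_{n+i} = paddedForm n i (A_l · per_n)` (`sl_exists_linSubst_eq_paddedForm`), isobaric of
degree `e₀ l + i` (`sl_isobaric_paddedForm`); by `aeval_formCoeff_paddedForm_liftHWV` the new
evaluation matrix is the `Δ_i`-twisted inner one, i.e. the untwisted one with column `l` scaled by
`((e₀ l + i)!/(e₀ l)!)^δ ≠ 0` (`sl_twistScalar`, `Matrix.det_mul_row`).
[Ikenmeyer–Panova 2017 Prop. 2.6(b); Bürgisser–Ikenmeyer–Panova 2019 Lemma 5.2, Thm. 5.4] -/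
theorem stub_isobaricSizeLift :
    ∀ (n i δ : ℕ) [NeZero n] [NeZero (n + i)] (μ : Nat.Partition (n * δ)), μ.parts.card ≤ n * n →
      ∀ (D : ℕ) (F : Fin D → MvPolynomial (DegIdx (MatIdx n) n) ℂ),
        (∀ i', F i' ∈ highestWeightSpace (coordRep (MatIdx n) ℂ n) (partitionWeightLex n μ)) →
        ∀ (A : Fin D → Matrix (MatIdx n) (MatIdx n) ℂ) (e₀ : Fin D → ℕ),
          (∀ l, ∀ e ∈ (linSubst (MatIdx n) ℂ (A l) (paddedPerFormLex ℂ n n)).support, e (topMatIdx n) = e₀ l) →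
          (Matrix.of fun i' l : Fin D => MvPolynomial.aeval
              (fun e : DegIdx (MatIdx n) n =>
                MvPolynomial.coeff e.1 (linSubst (MatIdx n) ℂ (A l) (paddedPerFormLex ℂ n n))) (F i')).det ≠ 0 →
          ∃ (F' : Fin D → MvPolynomial (DegIdx (MatIdx (n + i)) (n + i)) ℂ)
            (A' : Fin D → Matrix (MatIdx (n + i)) (MatIdx (n + i)) ℂ),
            (∀ i', F' i' ∈ highestWeightSpace (coordRep (MatIdx (n + i)) ℂ (n + i))
              (partitionWeightLex (n + i) (rowLift μ i))) ∧
            (∀ l, ∀ e ∈ (linSubst (MatIdx (n + i)) ℂ (A' l) (paddedPerFormLex ℂ (n + i) (n + i))).support,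
              e (topMatIdx (n + i)) = e₀ l + i) ∧
            (Matrix.of fun i' l : Fin D => MvPolynomial.aeval
                (fun e : DegIdx (MatIdx (n + i)) (n + i) =>
                  MvPolynomial.coeff e.1 (linSubst (MatIdx (n + i)) ℂ (A' l) (paddedPerFormLex ℂ (n + i) (n + i))))
                (F' i')).det ≠ 0 := by
  intro n i δ _ _ μ hμ D F hF A e₀ hiso hdet
  classical
  -- the padded points as `End`-orbit points of `per_{n+i}`
  choose M hM using fun l : Fin D => sl_exists_linSubst_eq_paddedForm n i (A l)
  have hhom : ∀ l, (linSubst (MatIdx n) ℂ (A l) (paddedPerFormLex ℂ n n)).IsHomogeneous n := fun l =>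
    linSubst_isHomogeneous _ (paddedPerFormLex_isHomogeneous ℂ le_rfl)
  have hFhom : ∀ i', (F i').IsHomogeneous δ := fun i' =>
    isHomogeneous_of_mem_highestWeightSpace (NeZero.ne n) (hF i') (size_partitionWeightLex' μ hμ)
  refine ⟨fun i' => liftHWV n i (F i'), M, fun i' => liftHWV_mem_highestWeightSpace μ hμ i (hF i'),
    fun l e he => ?_, ?_⟩
  · rw [hM l] at he
    exact sl_isobaric_paddedForm n i (hiso l) e he
  · -- the new evaluation matrix is the old one with column `l` scaled by `((e₀ l + i)_i)^δ`
    have hmat : (Matrix.of fun i' l : Fin D => MvPolynomial.aeval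
          (fun e : DegIdx (MatIdx (n + i)) (n + i) =>
            MvPolynomial.coeff e.1 (linSubst (MatIdx (n + i)) ℂ (M l) (paddedPerFormLex ℂ (n + i) (n + i))))
          (liftHWV n i (F i'))) =
        Matrix.of fun i' l : Fin D => ((((e₀ l + i).descFactorial i : ℕ) : ℂ) ^ δ) *
          MvPolynomial.aeval (fun e : DegIdx (MatIdx n) n =>
            MvPolynomial.coeff e.1 (linSubst (MatIdx n) ℂ (A l) (paddedPerFormLex ℂ n n))) (F i') := by
      ext i' l
      rw [Matrix.of_apply, Matrix.of_apply, hM l]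
      have h1 : MvPolynomial.aeval (fun e : DegIdx (MatIdx (n + i)) (n + i) =>
            MvPolynomial.coeff e.1 (paddedForm n i (linSubst (MatIdx n) ℂ (A l) (paddedPerFormLex ℂ n n))))
            (liftHWV n i (F i')) = _ :=
        aeval_formCoeff_paddedForm_liftHWV i (hhom l) (F i')
      rw [h1]
      exact sl_twistScalar n i δ (e₀ l) (F i') (hFhom i') _ (hiso l)
    rw [hmat, Matrix.det_mul_row]
    refine mul_ne_zero ?_ hdet
    refine Finset.prod_ne_zero_iff.mpr fun l _ => pow_ne_zero _ ?_
    have h0 : (e₀ l + i).descFactorial i ≠ 0 := by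
      rw [Ne, Nat.descFactorial_eq_zero_iff_lt]
      omega
    exact_mod_cast h0

end

end Summit.ValiantsHypothesis.ValiantsHypothesis.Theorems.TailFlip
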